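import Mathlib
import Summits.Langlands.Langlands.Theses.DyadicOddResidue
import Literature.NumberTheory.Automorphic.FontaineMazurHilbertTotallySplit
import Literature.NumberTheory.Automorphic.POrdinaryHeckeAlgebraGL2
import Literature.NumberTheory.Automorphic.AdeleBaseChange
import Literature.NumberTheory.GaloisRepresentations.ArtinRestriction
import Literature.NumberTheory.GaloisRepresentations.SorensenPatchingHypotheses
import Summits.Langlands.Langlands.Theorems.IrreducibilityBySelfDualityIrreducibleOffSectorRestrictTower
import Summits.Langlands.Langlands.Theorems.QuadraticWindowHostInducedRepMemberParity

/-!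
# Restriction of an odd Eisenstein `2`-adic `F`-family and of its points to `Γ_{F′}`
# (glue for the rev-L3 reshape of stub T1′ of line `ordinary-seed-propagation`,
# crux `DyadicEisensteinFM`, stmt-Langlands-18741; `--supports` file, closes nothing)

Helper file for the crux `Summit.Langlands.Langlands.Theses.DyadicOddResidue.DyadicEisensteinFM`
(Fontaine–Mazur at `ℓ = 2` for residually reducible odd regular `ρ : Γ_ℚ → GL₂(ℚ̄₂)`), line
`ordinary-seed-propagation` (`Cruxes/DyadicEisensteinFM/Lines/ordinary_seed_propagation.lean`).
Its stubs T2 / T1′ / C all carry the SAME "odd Eisenstein `2`-adic `F`-family" bundle for a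
Chenevier determinant `D : PseudoRep2 Γ_F A` over a number field `F`:

  `Continuous D.trace ∧ (∃ S finite, ∀ v ∉ S, ∀ 𝔓 ∣ v, ∀ σ ∈ I_𝔓, D.det σ = 1 ∧ ∀ τ, D.trace (τσ) = D.trace τ)
   ∧ (∀ φ c, IsComplexConjugation φ c → D.det c = -1) ∧ (∃ k i χ₁ χ₂, (D mod 𝔪_A) ⊗_i k = χ₁ ⊕ χ₂)`

(continuity; finite ramification; total oddness in the characteristic-`0` family; residually a sum
of two characters), and point clauses `x (D.trace σ) = tr (r σ)` for `ℚ̄₂`-points `x : A → ℚ̄₂`.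
The lead's rev-L3 reshape of T1′ routes through Thorne 2026, Theorem B (potential automorphy over
a finite totally real extension `F′/F`), after which the family and its points must be RESTRICTED
to `Γ_{F′}`.  This file proves that dictionary step, sorry-free and in the generality that costs
nothing:

* `eisensteinFamily_restrict` — the bundle for `(A, D)` over `F` implies the bundle for
  `(A, D ∘ res)` over `F′`, `res = absGaloisRestrict F F′ : Γ_{F′} → Γ_F` (any `[Algebra F F′]`
  of number fields; `A` any local topological ring): continuity by composition; finite
  ramification with `S′ :=` the places of `F′` above `S` (finite fibres of `w ↦ w ∩ 𝓞 F`,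
  `HeightOneSpectrum.tendsto_under_cofinite`; inertia at `𝔔 ∣ w` restricts into inertia at
  `ι⁻¹𝔔 ∣ v`, `exists_primesAbove_restrict`); oddness because complex conjugations of `F′`
  restrict to complex conjugations of `F` (`isComplexConjugation_absGaloisRestrict` of
  `Theorems/QuadraticWindowHostInducedRepMemberParity`); the residual clause with `χᵢ ∘ res`.
* `trace_restrictField_restrictField` — for a tower `K ⊆ F ⊆ F′` and `ρ : Γ_K → GL_n(A)`:
  `tr ((ρ|_{Γ_F})|_{Γ_{F′}})(σ) = tr (ρ|_{Γ_{F′}})(σ)` for every `σ` (the two restriction maps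
  differ by an inner automorphism of `Γ_K`, `exists_absGaloisRestrict_absGaloisRestrict_eq_conj`,
  the DISCHARGED `absGaloisRestrict_isConj_of_algHom`; traces are conjugation invariant).  For
  `K = ℚ` the scalar-tower hypothesis is automatic (`IsScalarTower.rat`).
* `eisensteinFamily_points_restrict` — the point clauses pass to `Γ_{F′}`: the point through
  `r : Γ_F → GL₂(ℚ̄₂)` becomes the point through `r|_{Γ_{F′}}`, and the point through `ρ|_{Γ_F}`
  (`ρ` over `ℚ`) becomes the point through `ρ|_{Γ_{F′}}` (NOT `(ρ|_{Γ_F})|_{Γ_{F′}}`, thanks to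
  the trace identity).
* `isIrreducible_restrictField_of_forall` — "irreducible over every finite extension `K/F`"
  gives "irreducible over every quadratic `K/F′`" for `r|_{Γ_{F′}}` (tower transport,
  `Theorems.IrreducibleOffSector.isIrreducible_restrictField_restrictField_iff`).
* `exists_seededFamily_restrict` — ASSEMBLY: from the `F`-family bundle, the two points `x₂`
  (through `ρ|_{Γ_F}`) and `y` (through `r`), non-CM-ness of `r` over the quadratic extensions of
  `F′` and classicality of `r|_{Γ_{F′}}` over `F′` (for every level datum and every `ι`), the
  `∃ (A′ …) (D′ …) (x₁ x₂′ …) (ρ₁ …), family ∧ points ∧ seed` block of T1′'s conclusion / of stub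
  C's hypotheses OVER `F′`, verbatim, witnessed by `A′ = A`, `D′ = D ∘ res`, `x₁ = y`, `x₂′ = x₂`,
  `ρ₁ = r|_{Γ_{F′}}`.  The FIELD clauses of that conclusion (`IsTotallyReal F′`, `IsGalois ℚ F′`,
  `2 ∤ d_{F′}`, `2` totally split in `F′`, `ρ|_{Γ_{F′}}` irreducible) are NOT produced here — they
  are properties of the particular `F′` and must come from the potential-automorphy input.

No definitions, no named facts, no `sorry`; standard axioms.  Nothing here closes the crux or a stub.
-/

set_option linter.dupNamespace false -- project-wide option (lakefile weak.linter.dupNamespace); `Summit.Langlands.Langlands` is the mandated namespace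
set_option linter.overlappingInstances false -- the registered bundles bind `[IsDomain A] … [IsLocalRing A]` (both mathematically required); `exists_seededFamily_restrict` keeps them verbatim

noncomputable section

namespace Summit.Langlands.Langlands.Theorems.DyadicEisensteinFM

open Summit.Langlands.Langlands.Theses.DyadicOddResidue
open Literature.NumberTheory.Automorphic Literature.NumberTheory.GaloisRepresentations
open Literature.NumberTheory.PAdicHodge
open scoped MatrixGroups
open NumberField IsDedekindDomain Filter Field

/-! ## 1. Restriction of the family bundle -/

section Family

variable {F : Type} [Field F] [NumberField F] (F' : Type) [Field F'] [NumberField F'] [Algebra F F']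
variable {A : Type} [CommRing A]

/-- **Finite ramification restricts.**  If `D` is unramified (trivial determinant and
`σ`-invariant trace on inertia) at every prime of `\bar ℤ_F` above every place `v ∉ S`, `S` finite,
then `D ∘ res` is so above every place `w` of `F′` not lying over `S` — a finite set, since
`w ↦ w ∩ 𝓞 F` has finite fibres (`HeightOneSpectrum.tendsto_under_cofinite`); inertia at `𝔔 ∣ w`
restricts into inertia at `ι⁻¹ 𝔔 ∣ v` (`exists_primesAbove_restrict`). [folklore] -/
theorem exists_finite_unramified_comp_absGaloisRestrict (D : PseudoRep2 (absoluteGaloisGroup F) A)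
    (h : ∃ S : Set (HeightOneSpectrum (𝓞 F)), S.Finite ∧ ∀ v ∉ S, ∀ 𝔓 ∈ v.primesAbove,
      ∀ σ ∈ 𝔓.inertia (absoluteGaloisGroup F), D.det σ = 1 ∧
        ∀ τ : absoluteGaloisGroup F, D.trace (τ * σ) = D.trace τ) :
    ∃ S : Set (HeightOneSpectrum (𝓞 F')), S.Finite ∧ ∀ v ∉ S, ∀ 𝔓 ∈ v.primesAbove,
      ∀ σ ∈ 𝔓.inertia (absoluteGaloisGroup F'),
        (D.comp (absGaloisRestrict F F').toMonoidHom).det σ = 1 ∧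
        ∀ τ : absoluteGaloisGroup F',
          (D.comp (absGaloisRestrict F F').toMonoidHom).trace (τ * σ) =
            (D.comp (absGaloisRestrict F F').toMonoidHom).trace τ := by
  obtain ⟨S, hS, hD⟩ := h
  refine ⟨(fun w : HeightOneSpectrum (𝓞 F') => w.under (𝓞 F)) ⁻¹' S, ?_, fun w hw 𝔔 h𝔔 σ hσ => ?_⟩
  · have hmem := HeightOneSpectrum.tendsto_under_cofinite (𝓞 F) (B := 𝓞 F') hS.compl_mem_cofinite
    rw [Filter.mem_map, mem_cofinite, Set.preimage_compl, compl_compl] at hmem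
    exact hmem
  · have hv : w.under (𝓞 F) ∉ S := hw
    obtain ⟨𝔓, h𝔓, hI, -⟩ := exists_primesAbove_restrict F F' (v := w.under (𝓞 F)) (w := w) rfl h𝔔
    obtain ⟨hdet, htr⟩ := hD _ hv 𝔓 h𝔓 _ (hI σ hσ)
    refine ⟨hdet, fun τ => ?_⟩
    change D.trace ((absGaloisRestrict F F').toMonoidHom (τ * σ)) =
      D.trace ((absGaloisRestrict F F').toMonoidHom τ)
    rw [map_mul]
    exact htr _

variable [TopologicalSpace A] [IsLocalRing A]

/-- **The odd Eisenstein family bundle restricts to `Γ_{F′}`.**  For number fields `F ⊆ F′` and a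
Chenevier determinant `D` of `Γ_F` with values in a local topological ring `A` satisfying the
family clauses of the line's stubs (continuity of the trace; finite ramification; `det D(c) = −1`
for every complex conjugation of `F`; residually a sum of two characters), the restriction
`D ∘ res` (`PseudoRep2.comp` along `absGaloisRestrict F F′`) satisfies the SAME clauses over `F′`:
continuity by composition; finite ramification by `exists_finite_unramified_comp_absGaloisRestrict`;
oddness because a complex conjugation of `F′` for `φ` restricts to a complex conjugation of `F` for
`φ|_F` (`isComplexConjugation_absGaloisRestrict`); the residual clause with the characters
`χᵢ ∘ res`.  Serre, *Abelian ℓ-adic representations* I §2; Chenevier 2014 §1.2 (functoriality of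
determinants). [folklore] -/
theorem eisensteinFamily_restrict : ∀ {F : Type} [Field F] [NumberField F] (F' : Type) [Field F'] [NumberField F'] [Algebra F F'] {A : Type} [CommRing A] [TopologicalSpace A] [IsLocalRing A] (D : Literature.NumberTheory.Automorphic.PseudoRep2 (Field.absoluteGaloisGroup F) A), (Continuous D.trace ∧ (∃ S : Set (IsDedekindDomain.HeightOneSpectrum (NumberField.RingOfIntegers F)), S.Finite ∧ ∀ v ∉ S, ∀ 𝔓 ∈ v.primesAbove, ∀ σ ∈ 𝔓.inertia (Field.absoluteGaloisGroup F), D.det σ = 1 ∧ ∀ τ : Field.absoluteGaloisGroup F, D.trace (τ * σ) = D.trace τ) ∧ (∀ (φ : F →+* ℝ) (c : Field.absoluteGaloisGroup F), Literature.NumberTheory.GaloisRepresentations.IsComplexConjugation φ c → ((D.det c : Aˣ) : A) = -1) ∧ (∃ (k : Type) (_ : Field k) (i : IsLocalRing.ResidueField A →+* k) (χ₁ χ₂ : Field.absoluteGaloisGroup F →* kˣ), (D.map (IsLocalRing.residue A)).map i = Literature.NumberTheory.Automorphic.PseudoRep2.ofCharacters χ₁ χ₂)) → (Continuous (D.comp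 (Literature.NumberTheory.GaloisRepresentations.absGaloisRestrict F F').toMonoidHom).trace ∧ (∃ S : Set (IsDedekindDomain.HeightOneSpectrum (NumberField.RingOfIntegers F')), S.Finite ∧ ∀ v ∉ S, ∀ 𝔓 ∈ v.primesAbove, ∀ σ ∈ 𝔓.inertia (Field.absoluteGaloisGroup F'), (D.comp (Literature.NumberTheory.GaloisRepresentations.absGaloisRestrict F F').toMonoidHom).det σ = 1 ∧ ∀ τ : Field.absoluteGaloisGroup F', (D.comp (Literature.NumberTheory.GaloisRepresentations.absGaloisRestrict F F').toMonoidHom).trace (τ * σ) = (D.comp (Literature.NumberTheory.GaloisRepresentations.absGaloisRestrict F F').toMonoidHom).trace τ) ∧ (∀ (φ : F' →+* ℝ) (c : Field.absoluteGaloisGroup F'), Literature.NumberTheory.GaloisRepresentations.IsComplexConjugation φ c → (((D.comp (Literature.NumberTheory.GaloisRepresentations.absGaloisRestrict F F').toMonoidHom).det c : Aˣ) : A) = -1) ∧ (∃ (k : Type) (_ : Field k) (i : IsLocalRing.ResidueField A →+* k) (χ₁ χ₂ : Field.absoluteGaloisGroup F' →* kˣ), ((D.comp (Literature.NumberTheory.GaloisRepresentations.absGaloisRestrict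 F F').toMonoidHom).map (IsLocalRing.residue A)).map i = Literature.NumberTheory.Automorphic.PseudoRep2.ofCharacters χ₁ χ₂)) := by
  intro F _ _ F' _ _ _ A _ _ _ D hfam
  obtain ⟨hcont, hS, hodd, k, hk, i, χ₁, χ₂, hres⟩ := hfam
  refine ⟨hcont.comp (absGaloisRestrict F F').continuous,
    exists_finite_unramified_comp_absGaloisRestrict F' D hS, fun φ c hc => ?_,
    k, hk, i, χ₁.comp (absGaloisRestrict F F').toMonoidHom,
      χ₂.comp (absGaloisRestrict F F').toMonoidHom, ?_⟩
  · exact hodd (φ.comp (algebraMap F F')) _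
      (HostInducedRep.OneTransparentPane.isComplexConjugation_absGaloisRestrict hc)
  · refine PseudoRep2.ext (funext fun σ => ?_) (MonoidHom.ext fun σ => Units.ext ?_)
    · have h := congrArg (fun E : PseudoRep2 (absoluteGaloisGroup F) k =>
        E.trace (absGaloisRestrict F F' σ)) hres
      simpa using h
    · have h := congrArg (fun E : PseudoRep2 (absoluteGaloisGroup F) k =>
        (E.det (absGaloisRestrict F F' σ) : k)) hres
      simpa using h

end Family

/-! ## 2. Restriction of the points -/

section Points

/-- **`tr ((ρ|_{Γ_F})|_{Γ_{F′}}) = tr (ρ|_{Γ_{F′}})` pointwise** for a tower `K ⊆ F ⊆ F′`: the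
restriction maps `Γ_{F′} → Γ_F → Γ_K` and `Γ_{F′} → Γ_K` (each defined through its own choice of
embedding of algebraic closures) differ by an inner automorphism of `Γ_K`
(`SorensenPatching.exists_absGaloisRestrict_absGaloisRestrict_eq_conj`, from the DISCHARGED
`absGaloisRestrict_isConj_of_algHom`; Milne, *Fields and Galois Theory*, Ch. 7), and the trace is
invariant under conjugation (`Matrix.trace_units_conj`). [folklore] -/
theorem trace_restrictField_restrictField {K F F' : Type*} [Field K] [Field F] [Field F']
    [Algebra K F] [Algebra F F'] [Algebra K F'] [IsScalarTower K F F']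
    {A : Type*} [CommRing A] [TopologicalSpace A] {n : ℕ} (ρ : FramedGaloisRep K A n)
    (σ : absoluteGaloisGroup F') :
    (((ρ.restrictField F).restrictField F') σ).val.trace = ((ρ.restrictField F') σ).val.trace := by
  obtain ⟨τ, hτ⟩ := SorensenPatching.exists_absGaloisRestrict_absGaloisRestrict_eq_conj K F F'
  rw [FramedGaloisRep.restrictField_apply, FramedGaloisRep.restrictField_apply, hτ σ, map_mul,
    map_mul, map_inv, FramedGaloisRep.restrictField_apply, Units.val_mul, Units.val_mul,
    Matrix.trace_mul_cycle, ← Units.val_mul, inv_mul_cancel, Units.val_one, Matrix.one_mul]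

variable {F : Type} [Field F] [NumberField F] (F' : Type) [Field F'] [NumberField F'] [Algebra F F']
variable {A : Type} [CommRing A] {p : ℕ} [Fact p.Prime] {n : ℕ}

/-- **The points of the family restrict.**  If `x, y : A → ℚ̄_p` are the points of the family `D`
through `ρ|_{Γ_F}` (`ρ` a representation of `Γ_ℚ`) and through `r : Γ_F → GL_n(ℚ̄_p)`, then, for
the restricted family `D ∘ res` of `Γ_{F′}`, they are the points through `ρ|_{Γ_{F′}}`
(`trace_restrictField_restrictField`, the `ℚ ⊆ F ⊆ F′` tower being automatic) and through
`r|_{Γ_{F′}}` (definitional). [folklore] -/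
theorem eisensteinFamily_points_restrict (D : PseudoRep2 (absoluteGaloisGroup F) A)
    (ρ : FramedGaloisRep ℚ (PadicAlgCl p) n) (r : FramedGaloisRep F (PadicAlgCl p) n)
    (x y : A →+* PadicAlgCl p)
    (hx : ∀ σ, x (D.trace σ) = ((ρ.restrictField F) σ).val.trace)
    (hy : ∀ σ, y (D.trace σ) = (r σ).val.trace) :
    (∀ σ, y ((D.comp (absGaloisRestrict F F').toMonoidHom).trace σ) =
        ((r.restrictField F') σ).val.trace) ∧
      ∀ σ, x ((D.comp (absGaloisRestrict F F').toMonoidHom).trace σ) =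
        ((ρ.restrictField F') σ).val.trace := by
  refine ⟨fun σ => ?_, fun σ => ?_⟩
  · rw [PseudoRep2.comp_trace, FramedGaloisRep.restrictField_apply]
    exact hy _
  · rw [PseudoRep2.comp_trace, ← trace_restrictField_restrictField (F := F) ρ σ,
      FramedGaloisRep.restrictField_apply F' (ρ.restrictField F)]
    exact hx _

omit [NumberField F] [NumberField F'] in
/-- **"Irreducible over every finite extension of `F`" restricts to "irreducible over every
quadratic extension of `F′`" for `r|_{Γ_{F′}}`**: a quadratic `K/F′` is a finite extension of `F`
(composite algebra structure, a scalar tower by construction), and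
`(r|_{Γ_{F′}})|_{Γ_K} ≃ r|_{Γ_K}` (`IrreducibleOffSector.isIrreducible_restrictField_restrictField_iff`).
The degree hypothesis is not even used. [folklore] -/
theorem isIrreducible_restrictField_of_forall {k : Type*} [Field k] [TopologicalSpace k]
    [IsTopologicalRing k] (r : FramedGaloisRep F k n)
    (h : ∀ (K : Type) [Field K] [NumberField K] [Algebra F K],
      (r.restrictField K).toGaloisRep.IsIrreducible) :
    ∀ (K : Type) [Field K] [NumberField K] [Algebra F' K], Module.finrank F' K = 2 →
      ((r.restrictField F').restrictField K).toGaloisRep.IsIrreducible := by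
  intro K _ _ _ _
  letI : Algebra F K := ((algebraMap F' K).comp (algebraMap F F')).toAlgebra
  haveI : IsScalarTower F F' K := IsScalarTower.of_algebraMap_eq fun _ => rfl
  exact (IrreducibleOffSector.isIrreducible_restrictField_restrictField_iff (F := F) (E := F')
    (L := K) r).2 (h K)

end Points

/-! ## 3. Assembly: the `∃ (A′ …)` block of T1′'s conclusion / stub C's hypotheses over `F′` -/

/-- **Restriction of a seeded odd Eisenstein `F`-family to `Γ_{F′}` (assembly).**  Let `ρ` be a
representation of `Γ_ℚ`, `F ⊆ F′` number fields, `(A, D)` an `F`-family satisfying the family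
bundle, `x₂` a continuous point through `ρ|_{Γ_F}` and `y` a continuous point through
`r : Γ_F → GL₂(ℚ̄₂)`.  Suppose `r|_{Γ_{F′}}` is irreducible over every quadratic extension of `F′`
and CLASSICAL over `F′` (attached a.e., for every level datum `hF′` and every `ι : ℚ̄₂ ≃ ℂ`, to an
`L`-algebraic cuspidal `π₁` on `GL₂(𝔸_{F′})` with a regular infinity type).  Then the
`∃ (A′ …) (D′ …) (x₁ x₂′ …) (ρ₁ …), family ∧ points ∧ seed` block of the conclusion of
`stub_ordinarySeedBecomesClassical` (= the family/points/seed hypotheses of `stub_automorphyPropagates`)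
holds OVER `F′`, verbatim, with `A′ = A`, `D′ = D ∘ res`, `x₁ = y`, `x₂′ = x₂`, `ρ₁ = r|_{Γ_{F′}}`
(`eisensteinFamily_restrict`, `eisensteinFamily_points_restrict`).  Pure dictionary; the field
clauses on `F′` are not part of this block. [folklore] -/
theorem exists_seededFamily_restrict (ρ : FramedGaloisRep ℚ (PadicAlgCl 2) 2)
    {F : Type} [Field F] [NumberField F] (F' : Type) [Field F'] [NumberField F'] [Algebra F F']
    (A : Type) [CommRing A] [IsDomain A] [IsNoetherianRing A] [IsLocalRing A] [TopologicalSpace A]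
    [IsTopologicalRing A] [CompactSpace A] [T2Space A]
    (D : PseudoRep2 (absoluteGaloisGroup F) A) (x₂ y : A →+* PadicAlgCl 2)
    (r : FramedGaloisRep F (PadicAlgCl 2) 2)
    (hfam : Continuous D.trace ∧
      (∃ S : Set (HeightOneSpectrum (𝓞 F)), S.Finite ∧ ∀ v ∉ S, ∀ 𝔓 ∈ v.primesAbove,
        ∀ σ ∈ 𝔓.inertia (absoluteGaloisGroup F), D.det σ = 1 ∧
          ∀ τ : absoluteGaloisGroup F, D.trace (τ * σ) = D.trace τ) ∧
      (∀ (φ : F →+* ℝ) (c : absoluteGaloisGroup F), IsComplexConjugation φ c →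
        ((D.det c : Aˣ) : A) = -1) ∧
      (∃ (k : Type) (_ : Field k) (i : IsLocalRing.ResidueField A →+* k)
        (χ₁ χ₂ : absoluteGaloisGroup F →* kˣ),
        (D.map (IsLocalRing.residue A)).map i = PseudoRep2.ofCharacters χ₁ χ₂))
    (hx₂ : Continuous x₂ ∧ ∀ σ, x₂ (D.trace σ) = ((ρ.restrictField F) σ).val.trace)
    (hy : Continuous y ∧ ∀ σ, y (D.trace σ) = (r σ).val.trace)
    (hnCM : ∀ (K : Type) [Field K] [NumberField K] [Algebra F' K], Module.finrank F' K = 2 →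
      ((r.restrictField F').restrictField K).toGaloisRep.IsIrreducible)
    (hclass : ∀ (hF : isCompact_glFiniteIntegralLevel 2 F') (ι : PadicAlgCl 2 ≃+* ℂ),
      ∃ π₁ : CuspidalAutomorphicRepData 2 F' hF, π₁.1.IsLAlgebraic ∧
        (∃ T : InfinityType F' 2, π₁.1.HasInfinityType T ∧ T.IsRegular) ∧
        SatakeFrobCompatibleAE ι π₁.1 (r.restrictField F')) :
    ∃ (A' : Type) (_ : CommRing A') (_ : IsDomain A') (_ : IsNoetherianRing A') (_ : IsLocalRing A')
      (_ : TopologicalSpace A') (_ : IsTopologicalRing A') (_ : CompactSpace A') (_ : T2Space A')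
      (D' : PseudoRep2 (absoluteGaloisGroup F') A') (x₁ x₂' : A' →+* PadicAlgCl 2)
      (ρ₁ : FramedGaloisRep F' (PadicAlgCl 2) 2),
      (Continuous D'.trace ∧
        (∃ S : Set (HeightOneSpectrum (𝓞 F')), S.Finite ∧ ∀ v ∉ S, ∀ 𝔓 ∈ v.primesAbove,
          ∀ σ ∈ 𝔓.inertia (absoluteGaloisGroup F'), D'.det σ = 1 ∧
            ∀ τ : absoluteGaloisGroup F', D'.trace (τ * σ) = D'.trace τ) ∧
        (∀ (φ : F' →+* ℝ) (c : absoluteGaloisGroup F'), IsComplexConjugation φ c →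
          ((D'.det c : A'ˣ) : A') = -1) ∧
        (∃ (k : Type) (_ : Field k) (i : IsLocalRing.ResidueField A' →+* k)
          (χ₁ χ₂ : absoluteGaloisGroup F' →* kˣ),
          (D'.map (IsLocalRing.residue A')).map i = PseudoRep2.ofCharacters χ₁ χ₂)) ∧
      (Continuous x₁ ∧ Continuous x₂' ∧ (∀ σ, x₁ (D'.trace σ) = (ρ₁ σ).val.trace) ∧
        (∀ σ, x₂' (D'.trace σ) = ((ρ.restrictField F') σ).val.trace)) ∧
      ((∀ (K : Type) [Field K] [NumberField K] [Algebra F' K], Module.finrank F' K = 2 →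
          (ρ₁.restrictField K).toGaloisRep.IsIrreducible) ∧
        (∀ (hF : isCompact_glFiniteIntegralLevel 2 F') (ι : PadicAlgCl 2 ≃+* ℂ),
          ∃ π₁ : CuspidalAutomorphicRepData 2 F' hF, π₁.1.IsLAlgebraic ∧
            (∃ T : InfinityType F' 2, π₁.1.HasInfinityType T ∧ T.IsRegular) ∧
            SatakeFrobCompatibleAE ι π₁.1 ρ₁)) := by
  obtain ⟨hy', hx'⟩ := eisensteinFamily_points_restrict F' D ρ r x₂ y hx₂.2 hy.2
  exact ⟨A, inferInstance, inferInstance, inferInstance, inferInstance, inferInstance, inferInstance,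
    inferInstance, inferInstance, D.comp (absGaloisRestrict F F').toMonoidHom, y, x₂,
    r.restrictField F', eisensteinFamily_restrict F' D hfam, ⟨hy.1, hx₂.1, hy', hx'⟩, hnCM, hclass⟩

end Summit.Langlands.Langlands.Theorems.DyadicEisensteinFM

end
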